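import Literature.Probability.LatticeModels.CurrentsAvoidShift
import Literature.Probability.LatticeModels.IsingPlusMixing
import HarnessLib

/-!
# Mixing of the edge-avoidance limits of the random currents

Trunk G02 (T-STATMECH), topic `Probability/LatticeModels`, namespace `Literature.StatMech`. For the
nearest-neighbour Ising model on `ℤ^d`, `β ≥ 0`, and finite sets of bonds `T`, `T'`, the limits
`lim_L P̂^#_{Λ_L,β}[n ≡ 0 on T]` (`plusCurrentAvoidLimit`, `freeCurrentAvoidLimit`,
`CurrentsEdgeAvoidance.lean`; by ADS15 (2.14) these are `⟨e^{-βK_T}⟩^#_β ∏ cosh`) factorise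
asymptotically under translation of one of the sets:

`lim_{‖x‖→∞} lim_L P̂^#_{Λ_L,β}[n ≡ 0 on T ∪ (T'+x)] = (lim_L P̂^#[n ≡ 0 on T]) (lim_L P̂^#[n ≡ 0 on T'])`

(`tendsto_plusCurrentAvoidLimit_union_shift`, `tendsto_freeCurrentAvoidLimit_union_shift`). This
is the content of the proof of R3 (ergodicity) in

* M. Aizenman, H. Duminil-Copin, V. Sidoravicius, *Random currents and continuity of Ising
  model's spontaneous magnetization*, Comm. Math. Phys. **334** (2015), proof of Thm. 2.3, R3
  (arXiv:1311.1937v3, p. 9): "the requirement can be further simplified to the proof that for any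
  two finite sets `E` and `F` of edges, `lim_{‖x₁‖→∞} P̂^#_β[𝒞_{E ∪ (x+F)}] = P̂^#_β[𝒞_E] P̂^#_β[𝒞_F]`.
  Using the expression (2.14) …
  `P̂^#_β[𝒞_{E∪(x+F)}] / (P̂^#_β[𝒞_E] P̂^#_β[𝒞_F]) = ⟨e^{-βK_E} e^{-βK_{x+F}}⟩^#_β / (⟨e^{-βK_E}⟩^#_β ⟨e^{-βK_F}⟩^#_β)`
  … this ratio tends to 1 … as a consequence of the mixing property of the states `⟨⋯⟩^#_β`",
  with Prop. A.1 (App. A, p. 15).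

## Proofs

* Plus boundary condition: expand `e^{-βK_T} = ∑_{S ⊆ T} c_{T,S} σ_{A(S)}` (`expNegBonds_eq_sum`);
  for `x` large `T` and `T'+x` are disjoint, the subsets of `T ∪ (T'+x)` are the `S₀ ∪ (S₁+x)`,
  the coefficients multiply and `A(S₀ ∪ (S₁+x)) = A(S₀) ∆ (A(S₁)+x)`; conclude by the mixing of
  the plus state on spin products (`tendsto_plusCorr_symmDiff_shift`, `IsingPlusMixing.lean`,
  i.e. ADS15 Prop. A.1, first bullet).
* Free boundary condition (ADS15 Prop. A.1, second bullet: the tilt by `e^{-βK_{x+T'}}`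
  "can be interpreted as an Ising measure with coupling constants" `J - J𝟙_{x+T'}`, i.e. with the
  bonds `x+T'` removed, and `⟨σ_A⟩⁰_{Λ_{‖x‖/2}} ≤ ⟨σ_A | e^{-βK_{x+T'}}⟩⁰ ≤ ⟨σ_A⟩⁰` by the
  Griffiths inequality): in finite volume `⟨e^{-βK_T} e^{-βK_{x+T'}}⟩⁰_{Λ_L} =
  ⟨e^{-βK_T}⟩⁰_{Λ_L ∖ (x+T')} ⟨e^{-βK_{x+T'}}⟩⁰_{Λ_L}` (change of graph as a tilt,
  `isingExpect_free_mul_of_le`), and each `⟨σ_{A(S)}⟩⁰_{Λ_L ∖ (x+T')}` is squeezed between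
  `⟨σ_{A(S)}⟩⁰_{Λ_{L'}}` (monotonicity in the graph and the volume, GKS II) and `⟨σ_{A(S)}⟩⁰_β`,
  both within `ε` of `⟨σ_{A(S)}⟩⁰_β` for `L'` large, which is allowed once `‖x‖` is large.

## Mathlib status

Anchors: `Filter.cofinite`, `Finset.eventually_cofinite_notMem`, `Finset.fold_union_inter`,
`Finset.sum_product`, `Metric.tendsto_nhds`; tree: `isingExpect_free_mul_of_le`,
`isingCorr_free_mono_graph`, `isingMeasure_free_congr_edgesIn`, `gks_two_holds`
(`GriffithsMonotonicity.lean`, `GKSInequalities.lean`), `isingCorr_free_le_of_subset`,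
`isingCorr_free_box_le_freeCorr`, `hasBoxLimit_isingCorr_free_holds`, `expNegBonds_eq_sum`,
`bondsSupport` (`CurrentsEdgeAvoidance.lean`), `pairShift`, `bondsSupport_image_pairShift`,
`freeCurrentAvoidLimit_image_pairShift` (`CurrentsAvoidShift.lean`).
-/

noncomputable section

open MeasureTheory Filter Topology Finset Literature.Probability.LatticeModels Literature.Probability.Percolation Literature.Probability.LatticeModels.GKSInequalities
open scoped symmDiff

namespace Literature.Probability.LatticeModels

variable (d : ℕ)

/-! ### Bounding boxes and eventual disjointness of translates -/

/-- A finite set of pairs of sites has all its endpoints in some box. [folklore] -/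
theorem exists_forall_mem_box_of_pairs (T : Finset (Sym2 (Site d))) :
    ∃ R : ℕ, ∀ e ∈ T, ∀ a ∈ e, a ∈ box d R := by
  classical
  obtain ⟨R, hR⟩ := exists_forall_subset_box d (T.biUnion Sym2.toFinset)
  exact ⟨R, fun e he a ha => hR R le_rfl (Finset.mem_biUnion.2 ⟨e, he, Sym2.mem_toFinset.2 ha⟩)⟩

/-- **Far translates of a finite bond set miss any fixed finite bond set**: for all but finitely
many `x`, `T` and `T' + x` are disjoint. [folklore] -/
theorem eventually_disjoint_image_pairShift (T T' : Finset (Sym2 (Site d))) :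
    ∀ᶠ x : Site d in cofinite, Disjoint T (T'.image (pairShift d x)) := by
  obtain ⟨R, hR⟩ := exists_forall_mem_box_of_pairs d T
  obtain ⟨R', hR'⟩ := exists_forall_mem_box_of_pairs d T'
  filter_upwards [(box d (R + R')).eventually_cofinite_notMem] with x hx
  rw [Finset.disjoint_left]
  intro e he he'
  obtain ⟨e', he'T, rfl⟩ := Finset.mem_image.1 he'
  induction e' using Sym2.ind with
  | _ a b =>
    have ha : a + x ∈ box d R := hR _ he _ (by rw [pairShift_mk]; exact Sym2.mem_mk_left _ _)
    have ha' : a ∈ box d R' := hR' _ he'T _ (Sym2.mem_mk_left _ _)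
    have h := Literature.Probability.LatticeModels.sub_mem_box_add ha ha'
    rw [add_sub_cancel_left] at h
    exact hx h

/-! ### Sums over the subsets of a disjoint union -/

/-- The subsets of a disjoint union `T ∪ T'` are the unions `S₀ ∪ S₁`, `S₀ ⊆ T`, `S₁ ⊆ T'`,
bijectively. [folklore] -/
theorem sum_powerset_union_of_disjoint {α M : Type*} [DecidableEq α] [AddCommMonoid M]
    {T T' : Finset α} (h : Disjoint T T') (f : Finset α → M) :
    ∑ S ∈ (T ∪ T').powerset, f S = ∑ S₀ ∈ T.powerset, ∑ S₁ ∈ T'.powerset, f (S₀ ∪ S₁) := by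
  rw [← Finset.sum_product' (β := M) T.powerset T'.powerset (fun S₀ S₁ => f (S₀ ∪ S₁))]
  refine (Finset.sum_nbij' (M := M) (fun p => p.1 ∪ p.2) (fun S => (S ∩ T, S ∩ T')) ?_ ?_ ?_ ?_ ?_).symm
  · intro p hp
    rw [Finset.mem_product, Finset.mem_powerset, Finset.mem_powerset] at hp
    exact Finset.mem_powerset.2 (Finset.union_subset_union hp.1 hp.2)
  · intro S hS
    rw [Finset.mem_product, Finset.mem_powerset, Finset.mem_powerset]
    exact ⟨Finset.inter_subset_right, Finset.inter_subset_right⟩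
  · intro p hp
    rw [Finset.mem_product, Finset.mem_powerset, Finset.mem_powerset] at hp
    have h1 : (p.1 ∪ p.2) ∩ T = p.1 := by
      rw [Finset.union_inter_distrib_right, Finset.inter_eq_left.2 hp.1,
        Finset.disjoint_iff_inter_eq_empty.1 (h.symm.mono_left hp.2), Finset.union_empty]
    have h2 : (p.1 ∪ p.2) ∩ T' = p.2 := by
      rw [Finset.union_inter_distrib_right, Finset.inter_eq_left.2 hp.2,
        Finset.disjoint_iff_inter_eq_empty.1 (h.mono_left hp.1), Finset.empty_union]
    rw [h1, h2]
  · intro S hS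
    rw [Finset.mem_powerset] at hS
    change S ∩ T ∪ S ∩ T' = S
    rw [← Finset.inter_union_distrib_left, Finset.inter_eq_left.2 hS]
  · intro p _; rfl

/-- The support of a disjoint union of bond sets: `A(S₀ ∪ S₁) = A(S₀) ∆ A(S₁)`. [folklore] -/
theorem bondsSupport_union_of_disjoint {S₀ S₁ : Finset (Sym2 (Site d))} (h : Disjoint S₀ S₁) :
    bondsSupport d (S₀ ∪ S₁) = bondsSupport d S₀ ∆ bondsSupport d S₁ := by
  unfold bondsSupport
  have h' := Finset.fold_union_inter (op := fun s t : Finset (Site d) => s ∆ t) (f := fun e : Sym2 (Site d) => e.toFinset)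
    (s₁ := S₀) (s₂ := S₁) (b₁ := (∅ : Finset (Site d))) (b₂ := (∅ : Finset (Site d)))
  rw [Finset.disjoint_iff_inter_eq_empty.1 h, Finset.fold_empty] at h'
  exact ((symmDiff_bot _).symm.trans h' :)

/-- The expansion coefficient `c_{T,S} = cosh(β)^{|T|} (-sinh β)^{|S|} / cosh(β)^{|S|}` of
`e^{-βK_T} = ∑_S c_{T,S} σ_{A(S)}`. [cite: AizenmanDuminilCopinSidoraviciusCMP2015, §2.2, eq. (2.14)] -/
def avoidCoeff (β : ℝ) (T S : Finset (Sym2 (Site d))) : ℝ :=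
  Real.cosh β ^ #T * (-Real.sinh β) ^ #S / Real.cosh β ^ #S

/-- The coefficients are multiplicative over disjoint unions (with a translate). [folklore] -/
theorem avoidCoeff_union_shift (β : ℝ) {T T' S₀ S₁ : Finset (Sym2 (Site d))} {x : Site d}
    (hT : Disjoint T (T'.image (pairShift d x))) (hS₀ : S₀ ⊆ T) (hS₁ : S₁ ⊆ T') :
    avoidCoeff d β (T ∪ T'.image (pairShift d x)) (S₀ ∪ S₁.image (pairShift d x)) =
      avoidCoeff d β T S₀ * avoidCoeff d β T' S₁ := by
  unfold avoidCoeff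
  have hinj := pairShift_injective d x
  have hS : Disjoint S₀ (S₁.image (pairShift d x)) :=
    hT.mono hS₀ (Finset.image_subset_image hS₁)
  rw [Finset.card_union_of_disjoint hT, Finset.card_union_of_disjoint hS,
    Finset.card_image_of_injective _ hinj, Finset.card_image_of_injective _ hinj, pow_add, pow_add,
    pow_add]
  have hc : Real.cosh β ^ #S₀ * Real.cosh β ^ #S₁ ≠ 0 :=
    mul_ne_zero (pow_ne_zero _ (Real.cosh_pos β).ne') (pow_ne_zero _ (Real.cosh_pos β).ne')
  field_simp

/-! ### Plus boundary condition -/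

/-- `plusCurrentAvoidLimit` in terms of `avoidCoeff`. [folklore] -/
theorem plusCurrentAvoidLimit_eq_sum (β : ℝ) (T : Finset (Sym2 (Site d))) :
    plusCurrentAvoidLimit d β T = ∑ S ∈ T.powerset, avoidCoeff d β T S * plusCorr d β 0 (bondsSupport d S) :=
  rfl

/-- **Asymptotic factorisation of the plus edge-avoidance limits** (ADS15 proof of Thm. 2.3, R3,
with Prop. A.1 for `⟨⋯⟩⁺`): for `β ≥ 0` and finite bond sets `T, T'`,
`lim_L P̂⁺_{Λ_L,β}[n ≡ 0 on T ∪ (T'+x)] → (lim_L P̂⁺[n ≡ 0 on T])(lim_L P̂⁺[n ≡ 0 on T'])` as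
`x → ∞` in `ℤ^d`. [cite: AizenmanDuminilCopinSidoraviciusCMP2015, Thm. 2.3 (proof of R3) and Prop. A.1] -/
theorem tendsto_plusCurrentAvoidLimit_union_shift {β : ℝ} (hβ : 0 ≤ β) (T T' : Finset (Sym2 (Site d))) :
    Tendsto (fun x : Site d => plusCurrentAvoidLimit d β (T ∪ T'.image (pairShift d x))) cofinite
      (𝓝 (plusCurrentAvoidLimit d β T * plusCurrentAvoidLimit d β T')) := by
  -- the double-sum expression, valid for `x` with `T ∩ (T'+x) = ∅`
  set g : Site d → ℝ := fun x => ∑ S₀ ∈ T.powerset, ∑ S₁ ∈ T'.powerset,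
    avoidCoeff d β T S₀ * avoidCoeff d β T' S₁ *
      plusCorr d β 0 (bondsSupport d S₀ ∆ (bondsSupport d S₁).map (Site.shift x).toEmbedding) with hg
  have heq : (fun x : Site d => plusCurrentAvoidLimit d β (T ∪ T'.image (pairShift d x))) =ᶠ[cofinite] g := by
    filter_upwards [eventually_disjoint_image_pairShift d T T'] with x hx
    rw [plusCurrentAvoidLimit_eq_sum, sum_powerset_union_of_disjoint hx, hg]
    refine Finset.sum_congr rfl fun S₀ hS₀ => ?_
    rw [sum_powerset_image_pairShift]
    refine Finset.sum_congr rfl fun S₁ hS₁ => ?_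
    have hS₀' := Finset.mem_powerset.1 hS₀
    have hS₁' := Finset.mem_powerset.1 hS₁
    rw [avoidCoeff_union_shift d β hx hS₀' hS₁',
      bondsSupport_union_of_disjoint d (hx.mono hS₀' (Finset.image_subset_image hS₁')),
      bondsSupport_image_pairShift, Finset.map_eq_image]
    rfl
  refine (tendsto_congr' heq).2 ?_
  -- each term converges by the mixing of the plus state
  have hlim : Tendsto g cofinite (𝓝 (∑ S₀ ∈ T.powerset, ∑ S₁ ∈ T'.powerset,
      avoidCoeff d β T S₀ * avoidCoeff d β T' S₁ *
        (plusCorr d β 0 (bondsSupport d S₀) * plusCorr d β 0 (bondsSupport d S₁)))) := by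
    refine tendsto_finsetSum _ fun S₀ _ => tendsto_finsetSum _ fun S₁ _ => ?_
    exact (tendsto_plusCorr_symmDiff_shift d hβ le_rfl _ _).const_mul _
  convert hlim using 2
  rw [plusCurrentAvoidLimit_eq_sum, plusCurrentAvoidLimit_eq_sum, Finset.sum_mul_sum]
  refine Finset.sum_congr rfl fun S₀ _ => Finset.sum_congr rfl fun S₁ _ => ?_
  ring

/-! ### Free boundary condition: deleting far-away bonds -/

/-- Deleting edges keeps a locally finite graph locally finite. [folklore] -/
instance instLocallyFiniteDeleteEdges {V : Type*} (G : SimpleGraph V) [G.LocallyFinite]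
    (R : Set (Sym2 V)) : (G.deleteEdges R).LocallyFinite := fun v =>
  ((G.neighborSet v).toFinite.subset fun _ hw => (SimpleGraph.deleteEdges_adj.1 hw).1).fintype

/-- The bonds inside `Λ` of the graph with the bonds `R` deleted. [folklore] -/
theorem edgesIn_deleteEdges {V : Type*} [DecidableEq V] (G : SimpleGraph V) [G.LocallyFinite]
    (R : Finset (Sym2 V)) (Λ : Finset V) :
    edgesIn (G.deleteEdges ↑R) Λ = edgesIn G Λ \ R := by
  ext e
  rw [Finset.mem_sdiff, mem_edgesIn_iff, mem_edgesIn_iff, SimpleGraph.edgeSet_deleteEdges,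
    Set.mem_sdiff, Finset.mem_coe]
  tauto

/-- `e^{-βK_{T ∪ R}} = e^{-βK_T} e^{-βK_R}` for disjoint bond sets. [folklore] -/
theorem expNegBonds_union {β : ℝ} {T R : Finset (Sym2 (Site d))} (h : Disjoint T R)
    (σ : SpinConfig (Site d)) :
    expNegBonds d β (T ∪ R) σ = expNegBonds d β T σ * expNegBonds d β R σ := by
  simp only [expNegBonds, Finset.sum_union h, mul_add, Real.exp_add]

/-- `e^{-βK_R} ∏_{e ∈ R} e^{β σ_e} = 1`. [folklore] -/
theorem expNegBonds_mul_prod_exp (β : ℝ) (R : Finset (Sym2 (Site d))) (σ : SpinConfig (Site d)) :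
    expNegBonds d β R σ * ∏ e ∈ R, Real.exp (β * bondSpin σ e) = 1 := by
  rw [expNegBonds, ← Real.exp_sum, ← Real.exp_add]
  have h : -β * ∑ e ∈ R, bondSpin σ e + ∑ e ∈ R, β * bondSpin σ e = 0 := by
    rw [← Finset.mul_sum]; ring
  rw [h, Real.exp_zero]

/-- **The tilt by `e^{-βK_R}` is the free measure with the bonds `R` deleted** (ADS15 Prop. A.1,
second bullet: the conditioned state "can be interpreted as an Ising measure with coupling
constants equal to `J_B + J̃_{B-x}`", here `J - J𝟙_R`, i.e. the graph `ℤ^d ∖ R`; the algebra is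
the change of graph as a tilt, `isingExpect_free_mul_of_le`): for `R ⊆ ℰ(Λ)` disjoint from `T`,
`⟨e^{-βK_{T ∪ R}}⟩^∅_{Λ} = ⟨e^{-βK_T}⟩^∅_{Λ; ℤ^d ∖ R} · ⟨e^{-βK_R}⟩^∅_{Λ}`. [cite: AizenmanDuminilCopinSidoraviciusCMP2015, Prop. A.1 (proof)] -/
theorem isingExpect_free_expNegBonds_union_eq {Λ : Finset (Site d)} {β : ℝ}
    {T R : Finset (Sym2 (Site d))} (hTR : Disjoint T R) (hR : R ⊆ edgesIn (zdGraph d) Λ) :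
    isingExpect (zdGraph d) Λ β 0 .free (expNegBonds d β (T ∪ R)) =
      isingExpect ((zdGraph d).deleteEdges ↑R) Λ β 0 .free (expNegBonds d β T) *
        isingExpect (zdGraph d) Λ β 0 .free (expNegBonds d β R) := by
  have hle : (zdGraph d).deleteEdges ↑R ≤ zdGraph d := SimpleGraph.deleteEdges_le _
  have hD : edgesIn (zdGraph d) Λ \ edgesIn ((zdGraph d).deleteEdges ↑R) Λ = R := by
    rw [edgesIn_deleteEdges, Finset.sdiff_sdiff_self_left, Finset.inter_eq_right.2 hR]
  -- the weight `W = ∏_{e ∈ R} e^{β σ_e}` and its expectation in the deleted graph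
  set W : SpinConfig (Site d) → ℝ := fun σ => ∏ e ∈ R, Real.exp (β * bondSpin σ e) with hW
  have hWpos : 0 < isingExpect ((zdGraph d).deleteEdges ↑R) Λ β 0 .free W :=
    isingExpect_pos _ Λ β 0 .free
      (Finset.measurable_prod _ fun e _ => Real.measurable_exp.comp ((measurable_bondSpin e).const_mul β))
      fun σ => Finset.prod_pos fun e _ => Real.exp_pos _
  -- the tilt identities for `f = e^{-βK_T} e^{-βK_R}` and for `f = e^{-βK_R}`
  have h1 := isingExpect_free_mul_of_le hle Λ β 0
    ((measurable_expNegBonds d β T).mul (measurable_expNegBonds d β R))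
  have h2 := isingExpect_free_mul_of_le hle Λ β 0 (measurable_expNegBonds d β R)
  rw [hD] at h1 h2
  have hf1 : (fun σ => (expNegBonds d β T * expNegBonds d β R) σ * ∏ e ∈ R, Real.exp (β * bondSpin σ e)) =
      expNegBonds d β T := by
    funext σ; rw [Pi.mul_apply, mul_assoc, expNegBonds_mul_prod_exp, mul_one]
  have hf2 : (fun σ => expNegBonds d β R σ * ∏ e ∈ R, Real.exp (β * bondSpin σ e)) = fun _ => (1 : ℝ) := by
    funext σ; exact expNegBonds_mul_prod_exp d β R σ
  rw [hf1] at h1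
  rw [hf2] at h2
  have hone : isingExpect ((zdGraph d).deleteEdges ↑R) Λ β 0 .free (fun _ => (1 : ℝ)) = 1 := by
    rw [isingExpect, integral_const, smul_eq_mul, mul_one, probReal_univ]
  rw [hone] at h2
  change isingExpect (zdGraph d) Λ β 0 .free (expNegBonds d β T * expNegBonds d β R) *
    isingExpect ((zdGraph d).deleteEdges ↑R) Λ β 0 .free W = _ at h1
  change isingExpect (zdGraph d) Λ β 0 .free (expNegBonds d β R) *
    isingExpect ((zdGraph d).deleteEdges ↑R) Λ β 0 .free W = 1 at h2
  have hunion : expNegBonds d β (T ∪ R) = expNegBonds d β T * expNegBonds d β R := by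
    funext σ; rw [Pi.mul_apply]; exact expNegBonds_union d hTR σ
  rw [hunion]
  -- divide the first identity by `⟨W⟩` and use the second
  have hW0 := hWpos.ne'
  have h2' : isingExpect (zdGraph d) Λ β 0 .free (expNegBonds d β R) =
      (isingExpect ((zdGraph d).deleteEdges ↑R) Λ β 0 .free W)⁻¹ :=
    eq_inv_of_mul_eq_one_left h2
  rw [h2', ← div_eq_mul_inv, eq_div_iff hW0, h1]

/-- The expansion `⟨e^{-βK_T}⟩ = ∑_S c_{T,S} ⟨σ_{A(S)}⟩` on any graph on `ℤ^d` (pointwise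
`expNegBonds_eq_sum`). [cite: AizenmanDuminilCopinSidoraviciusCMP2015, §2.2, eq. (2.14)] -/
theorem isingExpect_expNegBonds_eq_sum_avoidCoeff (G : SimpleGraph (Site d)) [G.LocallyFinite]
    (Λ : Finset (Site d)) (β h : ℝ) (bc : BoundaryCondition (Site d)) {T : Finset (Sym2 (Site d))}
    (hT : ∀ e ∈ T, ¬e.IsDiag) :
    isingExpect G Λ β h bc (expNegBonds d β T) =
      ∑ S ∈ T.powerset, avoidCoeff d β T S * isingCorr G Λ β h bc (bondsSupport d S) := by
  have hfun : expNegBonds d β T = fun σ => ∑ S ∈ T.powerset,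
      Real.cosh β ^ #T * (-Real.sinh β) ^ #S / Real.cosh β ^ #S * spinProduct (bondsSupport d S) σ :=
    funext (expNegBonds_eq_sum d β hT)
  rw [hfun, isingExpect_finset_sum' _ _ _ _ β _ _ fun S => (measurable_spinProduct _).const_mul _]
  refine Finset.sum_congr rfl fun S _ => ?_
  rw [isingExpect_const_mul' _ _ _ _ β _ (measurable_spinProduct _)]
  rfl

/-- `lim_L ⟨e^{-βK_T}⟩^∅_{Λ_L} = freeCurrentAvoidLimit d β T` for lattice `T` (ADS15 (2.14) with
the existence of the free state). [cite: AizenmanDuminilCopinSidoraviciusCMP2015, Thm. 2.3 (R1), proof] -/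
theorem tendsto_isingExpect_free_expNegBonds {β : ℝ} (hβ : 0 ≤ β) {T : Finset (Sym2 (Site d))}
    (hT : ↑T ⊆ (zdGraph d).edgeSet) :
    Tendsto (fun L : ℕ => isingExpect (zdGraph d) (box d L) β 0 .free (expNegBonds d β T)) atTop
      (𝓝 (freeCurrentAvoidLimit d β T)) := by
  have hdiag : ∀ e ∈ T, ¬e.IsDiag := fun e he => not_isDiag_of_mem_edgeSet d (hT he)
  have hfun : (fun L : ℕ => isingExpect (zdGraph d) (box d L) β 0 .free (expNegBonds d β T)) =
      fun L => ∑ S ∈ T.powerset, avoidCoeff d β T S *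
        isingCorr (zdGraph d) (box d L) β 0 .free (bondsSupport d S) :=
    funext fun L => isingExpect_expNegBonds_eq_sum_avoidCoeff d _ _ β 0 _ hdiag
  rw [hfun]
  exact tendsto_finsetSum _ fun S _ => (hasBoxLimit_isingCorr_free_holds hβ le_rfl _).const_mul _

/-- `freeCurrentAvoidLimit ≥ 0`. [folklore] -/
theorem freeCurrentAvoidLimit_nonneg {β : ℝ} (hβ : 0 ≤ β) {T : Finset (Sym2 (Site d))}
    (hT : ↑T ⊆ (zdGraph d).edgeSet) : 0 ≤ freeCurrentAvoidLimit d β T :=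
  ge_of_tendsto' (tendsto_isingExpect_free_expNegBonds d hβ hT) fun _ =>
    (isingExpect_pos _ _ β 0 _ (measurable_expNegBonds d β T) fun _ => Real.exp_pos _).le

/-- The supports `A(S)`, `S ⊆ T`, lie in `Λ_{L'}` once `T ⊆ ℰ(Λ_{L'})`. [folklore] -/
theorem bondsSupport_subset_of_subset_edgesIn {T S : Finset (Sym2 (Site d))} {Λ : Finset (Site d)}
    (hT : T ⊆ edgesIn (zdGraph d) Λ) (hS : S ⊆ T) : bondsSupport d S ⊆ Λ := by
  refine (fold_symmDiff_toFinset_subset S).trans (Finset.biUnion_subset.2 fun e he => ?_)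
  intro x hx
  exact (mem_edgesIn_iff.1 (hT (hS he))).2 x (Sym2.mem_toFinset.1 hx)

/-- **The Griffiths sandwich for the state with far bonds deleted** (ADS15 Prop. A.1, second
bullet: `⟨σ_A⟩⁰_{Λ_{‖x‖/2}} ≤ ⟨σ_A | e^{-βK_{x+F}}⟩⁰ ≤ ⟨σ_A⟩⁰`, finite-volume form): if
`A ⊆ Λ_{L'} ⊆ Λ_L` and no bond of `R` lies inside `Λ_{L'}`, then
`⟨σ_A⟩^∅_{Λ_{L'}} ≤ ⟨σ_A⟩^∅_{Λ_L; ℤ^d ∖ R} ≤ ⟨σ_A⟩^∅_{β}` (GKS II: monotonicity in the volume and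
in the graph, and the increasing box limit). [cite: AizenmanDuminilCopinSidoraviciusCMP2015, Prop. A.1 (proof)] -/
theorem isingCorr_free_deleteEdges_mem_Icc {β : ℝ} (hβ : 0 ≤ β) {A : Finset (Site d)} {L' L : ℕ}
    (hA : A ⊆ box d L') (hL : L' ≤ L) {R : Finset (Sym2 (Site d))}
    (hR : Disjoint R (edgesIn (zdGraph d) (box d L'))) :
    isingCorr ((zdGraph d).deleteEdges ↑R) (box d L) β 0 .free A ∈
      Set.Icc (isingCorr (zdGraph d) (box d L') β 0 .free A) (freeCorr d β 0 A) := by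
  have hle : (zdGraph d).deleteEdges ↑R ≤ zdGraph d := SimpleGraph.deleteEdges_le _
  constructor
  · -- `⟨σ_A⟩^∅_{Λ_{L'}} = ⟨σ_A⟩^∅_{Λ_{L'}; ℤ^d ∖ R} ≤ ⟨σ_A⟩^∅_{Λ_L; ℤ^d ∖ R}`
    have hE : edgesIn (zdGraph d) (box d L') = edgesIn ((zdGraph d).deleteEdges ↑R) (box d L') := by
      rw [edgesIn_deleteEdges, Finset.sdiff_eq_self_of_disjoint hR.symm]
    have heq : isingCorr (zdGraph d) (box d L') β 0 .free A =
        isingCorr ((zdGraph d).deleteEdges ↑R) (box d L') β 0 .free A := by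
      simp only [isingCorr, isingExpect, isingMeasure_free_congr_edgesIn hE]
    rw [heq]
    exact isingCorr_free_le_of_subset _ hβ le_rfl hA (box_mono d hL)
  · -- `⟨σ_A⟩^∅_{Λ_L; ℤ^d ∖ R} ≤ ⟨σ_A⟩^∅_{Λ_L} ≤ ⟨σ_A⟩^∅_β`
    refine (Literature.Probability.LatticeModels.isingCorr_free_mono_graph (fun Λ A B β h bc => gks_two_holds _) hle hβ le_rfl
      (hA.trans (box_mono d hL))).trans ?_
    exact isingCorr_free_box_le_freeCorr hβ le_rfl (hA.trans (box_mono d hL))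

/-- **Uniform approximation of `⟨e^{-βK_T}⟩^∅` with far bonds deleted** (the quantitative core of
ADS15 Prop. A.1, second bullet): for lattice `T` and `ε > 0` there is `L'` such that for every
bond set `R` with no bond inside `Λ_{L'}` and every `L ≥ L'`,
`|⟨e^{-βK_T}⟩^∅_{Λ_L; ℤ^d ∖ R} - freeCurrentAvoidLimit T| ≤ (∑_S |c_{T,S}|) ε`. [cite: AizenmanDuminilCopinSidoraviciusCMP2015, Prop. A.1 (proof)] -/
theorem exists_forall_abs_isingExpect_deleteEdges_sub_le {β : ℝ} (hβ : 0 ≤ β)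
    {T : Finset (Sym2 (Site d))} (hT : ↑T ⊆ (zdGraph d).edgeSet) {ε : ℝ} (hε : 0 < ε) :
    ∃ L' : ℕ, T ⊆ edgesIn (zdGraph d) (box d L') ∧ ∀ (R : Finset (Sym2 (Site d))),
      Disjoint R (edgesIn (zdGraph d) (box d L')) → ∀ L, L' ≤ L →
        |isingExpect ((zdGraph d).deleteEdges ↑R) (box d L) β 0 .free (expNegBonds d β T) -
            freeCurrentAvoidLimit d β T| ≤ (∑ S ∈ T.powerset, |avoidCoeff d β T S|) * ε := by
  have hdiag : ∀ e ∈ T, ¬e.IsDiag := fun e he => not_isDiag_of_mem_edgeSet d (hT he)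
  -- `L'` large: `T ⊆ ℰ(Λ_{L'})` and `⟨σ_{A(S)}⟩^∅_{Λ_{L'}} ≥ ⟨σ_{A(S)}⟩^∅_β - ε` for all `S ⊆ T`
  have h1 : ∀ᶠ L' : ℕ in atTop, ∀ S ∈ T.powerset,
      freeCorr d β 0 (bondsSupport d S) - ε < isingCorr (zdGraph d) (box d L') β 0 .free (bondsSupport d S) := by
    rw [eventually_all_finset]
    intro S _
    exact (tendsto_order.1 (hasBoxLimit_isingCorr_free_holds hβ le_rfl (bondsSupport d S))).1 _ (by linarith)
  obtain ⟨L', hL'⟩ := (h1.and (eventually_subset_edgesIn d hT)).exists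
  refine ⟨L', hL'.2, fun R hR L hL => ?_⟩
  rw [isingExpect_expNegBonds_eq_sum_avoidCoeff d _ _ β 0 _ hdiag, freeCurrentAvoidLimit,
    ← Finset.sum_sub_distrib, Finset.sum_mul]
  refine (Finset.abs_sum_le_sum_abs _ _).trans (Finset.sum_le_sum fun S hS => ?_)
  change |avoidCoeff d β T S * isingCorr ((zdGraph d).deleteEdges ↑R) (box d L) β 0 .free (bondsSupport d S) -
    avoidCoeff d β T S * freeCorr d β 0 (bondsSupport d S)| ≤ |avoidCoeff d β T S| * ε
  rw [← mul_sub, abs_mul]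
  refine mul_le_mul_of_nonneg_left ?_ (abs_nonneg _)
  have hAS : bondsSupport d S ⊆ box d L' :=
    bondsSupport_subset_of_subset_edgesIn d hL'.2 (Finset.mem_powerset.1 hS)
  have hIcc := isingCorr_free_deleteEdges_mem_Icc d hβ hAS hL hR
  have hlow := hL'.1 S hS
  rw [abs_le]
  constructor <;> linarith [hIcc.1, hIcc.2]

/-- Far translates of a finite bond set have no bond inside a fixed box. [folklore] -/
theorem eventually_disjoint_image_pairShift_edgesIn (T' : Finset (Sym2 (Site d))) (L' : ℕ) :
    ∀ᶠ x : Site d in cofinite, Disjoint (T'.image (pairShift d x)) (edgesIn (zdGraph d) (box d L')) := by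
  obtain ⟨R', hR'⟩ := exists_forall_mem_box_of_pairs d T'
  filter_upwards [(box d (L' + R')).eventually_cofinite_notMem] with x hx
  rw [Finset.disjoint_left]
  intro e he heL
  obtain ⟨e', he'T, rfl⟩ := Finset.mem_image.1 he
  induction e' using Sym2.ind with
  | _ a b =>
    have ha : a + x ∈ box d L' :=
      (mem_edgesIn_iff.1 heL).2 _ (by rw [pairShift_mk]; exact Sym2.mem_mk_left _ _)
    have ha' : a ∈ box d R' := hR' _ he'T _ (Sym2.mem_mk_left _ _)
    have h := Literature.Probability.LatticeModels.sub_mem_box_add ha ha'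
    rw [add_sub_cancel_left] at h
    exact hx h

/-- Translates of lattice bonds are lattice bonds. [folklore] -/
theorem coe_image_pairShift_subset_edgeSet {T' : Finset (Sym2 (Site d))}
    (hT' : ↑T' ⊆ (zdGraph d).edgeSet) (x : Site d) :
    (↑(T'.image (pairShift d x)) : Set (Sym2 (Site d))) ⊆ (zdGraph d).edgeSet := by
  intro e he
  obtain ⟨e', he', rfl⟩ := Finset.mem_image.1 (Finset.mem_coe.1 he)
  exact (pairShift_mem_edgeSet_iff d x e').2 (hT' he')

/-- **Asymptotic factorisation of the free edge-avoidance limits** (ADS15 proof of Thm. 2.3, R3,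
with Prop. A.1 for `⟨⋯⟩⁰` on the even functions `e^{-βK_E}`): for `β ≥ 0` and finite sets of
lattice bonds `T, T'`,
`lim_L P̂⁰_{Λ_L,β}[n ≡ 0 on T ∪ (T'+x)] → (lim_L P̂⁰[n ≡ 0 on T])(lim_L P̂⁰[n ≡ 0 on T'])` as
`x → ∞` in `ℤ^d`. [cite: AizenmanDuminilCopinSidoraviciusCMP2015, Thm. 2.3 (proof of R3) and Prop. A.1] -/
theorem tendsto_freeCurrentAvoidLimit_union_shift {β : ℝ} (hβ : 0 ≤ β) {T T' : Finset (Sym2 (Site d))}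
    (hT : ↑T ⊆ (zdGraph d).edgeSet) (hT' : ↑T' ⊆ (zdGraph d).edgeSet) :
    Tendsto (fun x : Site d => freeCurrentAvoidLimit d β (T ∪ T'.image (pairShift d x))) cofinite
      (𝓝 (freeCurrentAvoidLimit d β T * freeCurrentAvoidLimit d β T')) := by
  set C : ℝ := ∑ S ∈ T.powerset, |avoidCoeff d β T S| with hC
  set g : ℝ := freeCurrentAvoidLimit d β T' with hg
  have hC0 : 0 ≤ C := Finset.sum_nonneg fun S _ => abs_nonneg _
  have hg0 : 0 ≤ g := freeCurrentAvoidLimit_nonneg d hβ hT'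
  rw [Metric.tendsto_nhds]
  intro ε' hε'
  -- choose `ε` with `C ε g < ε'`
  obtain ⟨ε, hε, hεC⟩ : ∃ ε : ℝ, 0 < ε ∧ C * ε * g < ε' := by
    refine ⟨ε' / (2 * (C * g + 1)), by positivity, ?_⟩
    have hCg : C * g ≤ C * g + 1 := by linarith
    calc C * (ε' / (2 * (C * g + 1))) * g = (C * g) * ε' / (2 * (C * g + 1)) := by ring
      _ ≤ (C * g + 1) * ε' / (2 * (C * g + 1)) := by gcongr
      _ = ε' / 2 := by field_simp
      _ < ε' := by linarith
  obtain ⟨L', hTL', hL'⟩ := exists_forall_abs_isingExpect_deleteEdges_sub_le d hβ hT hε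
  filter_upwards [eventually_disjoint_image_pairShift d T T',
    eventually_disjoint_image_pairShift_edgesIn d T' L'] with x hx hxL'
  set R := T'.image (pairShift d x) with hR
  have hRE : (↑R : Set (Sym2 (Site d))) ⊆ (zdGraph d).edgeSet := coe_image_pairShift_subset_edgeSet d hT' x
  have hTRE : (↑(T ∪ R) : Set (Sym2 (Site d))) ⊆ (zdGraph d).edgeSet := by
    rw [Finset.coe_union]; exact Set.union_subset hT hRE
  -- finite volume: `P_L = F_L · G_L` with `|F_L - fCAL T| ≤ C ε` for `L` large
  have hPlim := tendsto_isingExpect_free_expNegBonds d hβ hTRE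
  have hGlim : Tendsto (fun L : ℕ => isingExpect (zdGraph d) (box d L) β 0 .free (expNegBonds d β R)) atTop (𝓝 g) := by
    have h := tendsto_isingExpect_free_expNegBonds d hβ hRE
    rwa [hR, freeCurrentAvoidLimit_image_pairShift d hβ] at h
  have hbound : ∀ᶠ L : ℕ in atTop,
      |isingExpect (zdGraph d) (box d L) β 0 .free (expNegBonds d β (T ∪ R)) -
        freeCurrentAvoidLimit d β T * isingExpect (zdGraph d) (box d L) β 0 .free (expNegBonds d β R)| ≤
      C * ε * isingExpect (zdGraph d) (box d L) β 0 .free (expNegBonds d β R) := by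
    filter_upwards [eventually_ge_atTop L', eventually_subset_edgesIn d hRE] with L hL hRL
    have hGpos : 0 < isingExpect (zdGraph d) (box d L) β 0 .free (expNegBonds d β R) :=
      isingExpect_pos _ _ β 0 _ (measurable_expNegBonds d β R) fun σ => Real.exp_pos _
    rw [isingExpect_free_expNegBonds_union_eq d hx hRL, ← sub_mul, abs_mul, abs_of_pos hGpos]
    exact mul_le_mul_of_nonneg_right (hL' R hxL' L hL) hGpos.le
  -- pass to the limit `L → ∞`
  have hle : |freeCurrentAvoidLimit d β (T ∪ R) - freeCurrentAvoidLimit d β T * g| ≤ C * ε * g :=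
    le_of_tendsto_of_tendsto ((hPlim.sub (hGlim.const_mul _)).abs) (hGlim.const_mul _) hbound
  rw [Real.dist_eq]
  exact hle.trans_lt hεC

end Literature.Probability.LatticeModels
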